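import Summits.CriticalPhenomena.PercolationContinuityZ3.Theorems.PercNearOneGluingNoHeavyLowerTailThreePointProductFormFibreCutVertex
import HarnessLib

/-!
# The product form `#bad² ≤ #P1·#P2` in the fibre language: APEX TRANSFER ACROSS A CUT VERTEX
# (Sahi programme, prover prim-sahi-p2 gen 55)

Support file (`--supports stmt-CriticalPhenomena-4575`, helper); continues `…ThreePointProductFormFibreCutVertex` (gen 54: the case in which
the apex `a` itself separates `s` from `c`).  Standard axioms, no sorries, no named facts, no definitions.
Memo `run/shared/lean/prim/prim-sahi/FROM-prim-sahi-p2-gen55-REDUCTIONS.md` §1 (reduction R1).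

SETTING.  A finite multigraph `(V, α, ends)`, a vertex set `A` (the apex side) and a cut vertex `u ∉ A` separating `A` from the rest:
every label has all its endpoints in `A ∪ {u}` or all its endpoints in `Aᶜ ∪ {u}` (spelled out, as in the cut-vertex file).  The apex `a`
lies in `A`; both terminals `s, c` lie outside `A` and differ from `u`.  Write `R z x y` for open connection and `♭ₓz = clusterFlip ends x z̄`
for the flat at `x` (complement on the labels touching the open cluster of `x`).
* `reachable_cut_iff` [this work] — `R z a s ↔ R z a u ∧ R z u s`: every connection from the apex side to a terminal passes through `u`.
* `reachable_iff_of_agree_outside` [this work] — LOCALITY for two vertices of `Aᶜ` (the cut vertex allowed): their connection is determined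
  by the non-loop labels outside `A` (a path between them either avoids `u`, and then stays outside `A`, or splits at `u`).
* `flat_eq_flat_of_reachable` [this work] — if `R z a u` then `♭ₐ z = ♭ᵤ z` (the two open clusters coincide).
* `bad_iff_apexTransfer`, `sa_iff_apexTransfer` [this work] — POINTWISE: `bad(a; s, c) = {R a u} ∩ bad(u; s, c)`, `P1(a) = {R a u} ∩ P1(u)`,
  `P2(a) = {R a u} ∩ P2(u)` (if `a ↮ u` the flat at `a` changes only apex-side labels, so `s ↮ c` persists).
* **`productForm_of_apexTransfer`** [this work] — REDUCTION R1: `(P)` for the terminals `(s, u, c)` (apex `u`) on the same multigraph implies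
  `(P)` for `(s, a, c)`: with the independence count of the cut-vertex file, `#bad(a)·#univ = #{R a u}·#bad(u)` and likewise for `P1, P2`,
  so `#bad(a)² ≤ #P1(a)·#P2(a)` is `#{R a u}²` times the hypothesis.  Together with `productForm_of_hanging` (the apex side is a part
  hanging at `u` for the terminals `s, u, c`) this moves the apex across any cut vertex separating it from both terminals; it contains the
  pendant-apex reduction of `…FibrePendant` (there `A = {a}`), now for an arbitrary apex-side block and any number of parallel labels.
[folklore] (walks through a cut vertex; product counting); [cite: Gladkov2024, Conjecture 10.1 (p. 18), arXiv:2408.08457] for CONJECTURE (P).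
-/

namespace Summit.CriticalPhenomena.PercolationContinuityZ3.Theorems.ProductFormFibre

open Finset Literature.Probability.Percolation
open Summit.CriticalPhenomena.PercolationContinuityZ3.Theorems.ThreePointCPIClusterSwap
  (QTouch clusterFlip clusterFlip_of_qtouch clusterFlip_of_not_qtouch)

variable {V α : Type*}

/-! ### 1. Connections through the cut vertex; locality outside the apex side -/

section CutLocality

variable [DecidableEq V] (ends : α → Sym2 V) (u : V) (A : Set V)

/-- **Every connection from the apex side to the outside passes through the cut vertex**: for `x ∈ A` and `y ∉ A ∪ {u}`,
`R z x y ↔ R z x u ∧ R z u y`. [this work] -/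
theorem reachable_cut_iff (hsep : ∀ l : α, (∀ v ∈ ends l, v ∈ A ∨ v = u) ∨ (∀ v ∈ ends l, v ∉ A ∨ v = u)) (huA : u ∉ A)
    (z : α → Bool) {x y : V} (hx : x ∈ A) (hy : y ∉ A) :
    (openGraph (labelledOpen ends z)).Reachable x y ↔
      (openGraph (labelledOpen ends z)).Reachable x u ∧ (openGraph (labelledOpen ends z)).Reachable u y :=
  ⟨fun h => reachable_apex_of_reachable ends u A hsep huA z hx hy h, fun h => h.1.trans h.2⟩

/-- **LOCALITY outside the apex side.**  If `z'` is open on every `z`-open non-loop label outside `A`, then every `z`-connection between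
two vertices of `Aᶜ` (the cut vertex `u` allowed) is a `z'`-connection. [this work] -/
theorem reachable_of_agree_outside
    (hsep : ∀ l : α, (∀ v ∈ ends l, v ∈ A ∨ v = u) ∨ (∀ v ∈ ends l, v ∉ A ∨ v = u)) (huA : u ∉ A)
    {z z' : α → Bool}
    (hagree : ∀ l, (∀ v ∈ ends l, v ∈ {v : V | v ∉ A ∧ v ≠ u} ∨ v = u) → ¬ (ends l).IsDiag → z l = true → z' l = true)
    {x y : V} (hx : x ∈ {v : V | v ∉ A ∧ v ≠ u} ∨ x = u) (hy : y ∈ {v : V | v ∉ A ∧ v ≠ u} ∨ y = u)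
    (h : (openGraph (labelledOpen ends z)).Reachable x y) :
    (openGraph (labelledOpen ends z')).Reachable x y := by
  set T : Set V := {v : V | v ∉ A ∧ v ≠ u} with hT
  have hsepT := separates_compl ends u A hsep
  have huT : u ∉ T := fun h => h.2 rfl
  rcases hx with hx | rfl
  swap
  · exact reachable_of_agree_inside ends x T hsepT huT hagree hy h
  rcases hy with hy | rfl
  swap
  · exact (reachable_of_agree_inside ends y T hsepT huT hagree (Or.inl hx) h.symm).symm
  -- both endpoints in `T`: a path either meets `u` (split there) or stays inside `T`
  obtain ⟨p⟩ := h
  by_cases hu : u ∈ p.support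
  · have h1 : (openGraph (labelledOpen ends z)).Reachable u x := ⟨(p.takeUntil u hu).reverse⟩
    have h2 : (openGraph (labelledOpen ends z)).Reachable u y := ⟨p.dropUntil u hu⟩
    exact (reachable_of_agree_inside ends u T hsepT huT hagree (Or.inl hx) h1).symm.trans
      (reachable_of_agree_inside ends u T hsepT huT hagree (Or.inl hy) h2)
  · have hsupp : ∀ w ∈ p.support, w ∈ T := support_subset_of_walk ends u T hsepT huT z p hx hu
    refine reachable_of_walk_of_labels ends z z' p fun l hl he => ?_
    have heG := p.edges_subset_edgeSet he
    have hnd : ¬ (ends l).IsDiag := by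
      rw [openGraph, SimpleGraph.edgeSet_fromEdgeSet] at heG; exact heG.2
    refine hagree l ?_ hnd hl
    obtain ⟨v, w, hends⟩ : ∃ v w, ends l = s(v, w) := by
      induction ends l using Sym2.ind with
      | h v w => exact ⟨v, w, rfl⟩
    rw [hends] at he hnd
    have hv := hsupp v (p.fst_mem_support_of_mem_edges he)
    have hw := hsupp w (p.snd_mem_support_of_mem_edges he)
    have hvw : v ≠ w := fun h => hnd (by rw [h]; exact Sym2.mk_isDiag_iff.mpr rfl)
    exact inside_of_edge ends u T hsepT hends (Or.inl hv) (Or.inl hw) hvw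

/-- **Locality outside the apex side, symmetric form**: configurations agreeing on the non-loop labels outside `A` have the same
connections between vertices of `Aᶜ`. [this work] -/
theorem reachable_iff_of_agree_outside
    (hsep : ∀ l : α, (∀ v ∈ ends l, v ∈ A ∨ v = u) ∨ (∀ v ∈ ends l, v ∉ A ∨ v = u)) (huA : u ∉ A)
    {z z' : α → Bool}
    (hagree : ∀ l, (∀ v ∈ ends l, v ∈ {v : V | v ∉ A ∧ v ≠ u} ∨ v = u) → ¬ (ends l).IsDiag → z l = z' l)
    {x y : V} (hx : x ∈ {v : V | v ∉ A ∧ v ≠ u} ∨ x = u) (hy : y ∈ {v : V | v ∉ A ∧ v ≠ u} ∨ y = u) :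
    (openGraph (labelledOpen ends z)).Reachable x y ↔ (openGraph (labelledOpen ends z')).Reachable x y :=
  ⟨reachable_of_agree_outside ends u A hsep huA (fun l hl hd h => (hagree l hl hd) ▸ h) hx hy,
   reachable_of_agree_outside ends u A hsep huA (fun l hl hd h => (hagree l hl hd).symm ▸ h) hx hy⟩

end CutLocality

/-! ### 2. The flats at `a` and at `u` coincide when `a ↔ u` -/

/-- **If `a ↔ u` in `z` then `♭ₐ z = ♭ᵤ z`**: the open clusters of `a` and `u` coincide, so the same labels are complemented. [this work] -/
theorem flat_eq_flat_of_reachable (ends : α → Sym2 V) {a u : V} (z : α → Bool)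
    (h : (openGraph (labelledOpen ends z)).Reachable a u) :
    clusterFlip ends a (fun x => !z x) = clusterFlip ends u (fun x => !z x) := by
  classical
  funext l
  have hq : QTouch ends a (fun x => !z x) l ↔ QTouch ends u (fun x => !z x) l := by
    rw [qtouch_compl_iff, qtouch_compl_iff]
    constructor
    · rintro ⟨v, hv, hr⟩; exact ⟨v, hv, h.symm.trans hr⟩
    · rintro ⟨v, hv, hr⟩; exact ⟨v, hv, h.trans hr⟩
  by_cases h1 : QTouch ends a (fun x => !z x) l
  · rw [clusterFlip_of_qtouch ends a _ h1, clusterFlip_of_qtouch ends u _ (hq.1 h1)]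
  · rw [clusterFlip_of_not_qtouch ends a _ h1, clusterFlip_of_not_qtouch ends u _ (fun h' => h1 (hq.2 h'))]

/-! ### 3. Pointwise transfer of the three events -/

section Pointwise

variable [DecidableEq V] (ends : α → Sym2 V) (u : V) (A : Set V)

/-- If `a ↮ u` then the flat at `a` does not change the non-loop labels outside the apex side. [this work] -/
theorem flat_apply_eq_self_of_not_reachable
    (hsep : ∀ l : α, (∀ v ∈ ends l, v ∈ A ∨ v = u) ∨ (∀ v ∈ ends l, v ∉ A ∨ v = u)) (huA : u ∉ A)
    {a : V} (ha : a ∈ A) (z : α → Bool) (hau : ¬ (openGraph (labelledOpen ends z)).Reachable a u)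
    {l : α} (hl : ∀ v ∈ ends l, v ∈ {v : V | v ∉ A ∧ v ≠ u} ∨ v = u) :
    clusterFlip ends a (fun x => !z x) l = z l := by
  classical
  have hnq : ¬ QTouch ends a (fun x => !z x) l := by
    rw [qtouch_compl_iff]
    rintro ⟨v, hv, hr⟩
    rcases hl v hv with hvT | rfl
    · exact hau ((reachable_cut_iff ends u A hsep huA z ha hvT.1).1 hr).1
    · exact hau hr
  rw [clusterFlip_of_not_qtouch ends a _ hnq, Bool.not_not]

/-- **`bad(a; s, c) = {a ↔ u} ∩ bad(u; s, c)` pointwise.**  For the apex `a ∈ A` and terminals `s, c ∉ A ∪ {u}`: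
`(a ↮ s ∧ a ↮ c ∧ s ↮ c in z) ∧ s ↔ c in ♭ₐz` iff `a ↔ u in z` and `(u ↮ s ∧ u ↮ c ∧ s ↮ c in z) ∧ s ↔ c in ♭ᵤz`. [this work] -/
theorem bad_iff_apexTransfer
    (hsep : ∀ l : α, (∀ v ∈ ends l, v ∈ A ∨ v = u) ∨ (∀ v ∈ ends l, v ∉ A ∨ v = u)) (huA : u ∉ A)
    {a s c : V} (ha : a ∈ A) (hs : s ∉ A) (hsu : s ≠ u) (hc : c ∉ A) (hcu : c ≠ u) (z : α → Bool) :
    ((¬ (openGraph (labelledOpen ends z)).Reachable a s ∧ ¬ (openGraph (labelledOpen ends z)).Reachable a c ∧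
        ¬ (openGraph (labelledOpen ends z)).Reachable s c) ∧
      (openGraph (labelledOpen ends (clusterFlip ends a fun x => !z x))).Reachable s c) ↔
    ((openGraph (labelledOpen ends z)).Reachable a u ∧
      ((¬ (openGraph (labelledOpen ends z)).Reachable u s ∧ ¬ (openGraph (labelledOpen ends z)).Reachable u c ∧
          ¬ (openGraph (labelledOpen ends z)).Reachable s c) ∧
        (openGraph (labelledOpen ends (clusterFlip ends u fun x => !z x))).Reachable s c)) := by
  have hsT : s ∈ {v : V | v ∉ A ∧ v ≠ u} ∨ s = u := Or.inl ⟨hs, hsu⟩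
  have hcT : c ∈ {v : V | v ∉ A ∧ v ≠ u} ∨ c = u := Or.inl ⟨hc, hcu⟩
  constructor
  · rintro ⟨⟨h1, h2, h3⟩, h4⟩
    -- `a ↔ u`: otherwise the flat at `a` leaves the outside untouched and `s ↮ c` would persist
    have hau : (openGraph (labelledOpen ends z)).Reachable a u := by
      by_contra hau
      refine h3 ((reachable_iff_of_agree_outside ends u A hsep huA (z := clusterFlip ends a fun x => !z x) (z' := z)
        (fun l hl _ => flat_apply_eq_self_of_not_reachable ends u A hsep huA ha z hau hl) hsT hcT).1 h4)
    refine ⟨hau, ⟨fun h => h1 (hau.trans h), fun h => h2 (hau.trans h), h3⟩, ?_⟩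
    rwa [← flat_eq_flat_of_reachable ends z hau]
  · rintro ⟨hau, ⟨h1, h2, h3⟩, h4⟩
    refine ⟨⟨fun h => h1 (hau.symm.trans h), fun h => h2 (hau.symm.trans h), h3⟩, ?_⟩
    rwa [flat_eq_flat_of_reachable ends z hau]

/-- **`{a ↔ s, a ↮ c} = {a ↔ u} ∩ {u ↔ s, u ↮ c}` pointwise** (apex `a ∈ A`, terminals `s, c ∉ A ∪ {u}`); with `s, c` exchanged this is
the statement for `P2`. [this work] -/
theorem sa_iff_apexTransfer
    (hsep : ∀ l : α, (∀ v ∈ ends l, v ∈ A ∨ v = u) ∨ (∀ v ∈ ends l, v ∉ A ∨ v = u)) (huA : u ∉ A)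
    {a s c : V} (ha : a ∈ A) (hs : s ∉ A) (z : α → Bool) :
    ((openGraph (labelledOpen ends z)).Reachable a s ∧ ¬ (openGraph (labelledOpen ends z)).Reachable a c) ↔
    ((openGraph (labelledOpen ends z)).Reachable a u ∧
      ((openGraph (labelledOpen ends z)).Reachable u s ∧ ¬ (openGraph (labelledOpen ends z)).Reachable u c)) := by
  constructor
  · rintro ⟨h1, h2⟩
    have h := (reachable_cut_iff ends u A hsep huA z ha hs).1 h1
    exact ⟨h.1, h.2, fun h' => h2 (h.1.trans h')⟩
  · rintro ⟨hau, h1, h2⟩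
    exact ⟨hau.trans h1, fun h' => h2 (hau.symm.trans h')⟩

end Pointwise

/-! ### 4. Reduction R1: the apex moves across the cut vertex -/

section Transfer

variable [Fintype α] [DecidableEq α] [DecidableEq V]

open Classical in
/-- **APEX TRANSFER (reduction R1).**  On a finite multigraph `(V, α, ends)` let the cut vertex `u ∉ A` separate the apex side `A ∋ a` from
the rest (every label inside `A ∪ {u}` or inside `Aᶜ ∪ {u}`), and let both terminals `s, c` lie outside `A ∪ {u}`.  If `(P)` holds for the
terminals `(s, u, c)` with apex `u` — `#bad(u)² ≤ #P1(u)·#P2(u)` on the same multigraph — then `(P)` holds for `(s, a, c)`: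
`#{a ↮ s, a ↮ c, s ↮ c in z, s ↔ c in ♭ₐz}² ≤ #{a ↔ s, a ↮ c}·#{a ↔ c, a ↮ s}`.  Indeed `#E(a)·#univ = #{a ↔ u}·#E(u)` for each of the
three events (`bad_iff_apexTransfer`, `sa_iff_apexTransfer` and the independence count `card_and_mul_card_univ`). [this work] -/
theorem productForm_of_apexTransfer (ends : α → Sym2 V) (u a s c : V) (A : Set V)
    (hsep : ∀ l : α, (∀ v ∈ ends l, v ∈ A ∨ v = u) ∨ (∀ v ∈ ends l, v ∉ A ∨ v = u))
    (huA : u ∉ A) (ha : a ∈ A) (hs : s ∉ A) (hsu : s ≠ u) (hc : c ∉ A) (hcu : c ≠ u)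
    (hP : (univ.filter fun z : α → Bool =>
        (¬ (openGraph (labelledOpen ends z)).Reachable u s ∧ ¬ (openGraph (labelledOpen ends z)).Reachable u c ∧
            ¬ (openGraph (labelledOpen ends z)).Reachable s c) ∧
          (openGraph (labelledOpen ends (clusterFlip ends u fun x => !z x))).Reachable s c).card ^ 2 ≤
      (univ.filter fun z : α → Bool =>
        (openGraph (labelledOpen ends z)).Reachable u s ∧ ¬ (openGraph (labelledOpen ends z)).Reachable u c).card *
      (univ.filter fun z : α → Bool =>
        (openGraph (labelledOpen ends z)).Reachable u c ∧ ¬ (openGraph (labelledOpen ends z)).Reachable u s).card) :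
    (univ.filter fun z : α → Bool =>
        (¬ (openGraph (labelledOpen ends z)).Reachable a s ∧ ¬ (openGraph (labelledOpen ends z)).Reachable a c ∧
          ¬ (openGraph (labelledOpen ends z)).Reachable s c) ∧
        (openGraph (labelledOpen ends (clusterFlip ends a fun x => !z x))).Reachable s c).card ^ 2 ≤
    (univ.filter fun z : α → Bool =>
        (openGraph (labelledOpen ends z)).Reachable a s ∧ ¬ (openGraph (labelledOpen ends z)).Reachable a c).card *
    (univ.filter fun z : α → Bool =>
        (openGraph (labelledOpen ends z)).Reachable a c ∧ ¬ (openGraph (labelledOpen ends z)).Reachable a s).card := by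
  -- the outside of the cut vertex
  set T : Set V := {v : V | v ∉ A ∧ v ≠ u} with hT
  have hsepT := separates_compl ends u A hsep
  have huT : u ∉ T := fun h => h.2 rfl
  have hsT : s ∈ T ∨ s = u := Or.inl ⟨hs, hsu⟩
  have hcT : c ∈ T ∨ c = u := Or.inl ⟨hc, hcu⟩
  -- inside labels: non-loop labels within `A ∪ {u}`
  let ins : α → Prop := fun l => (∀ v ∈ ends l, v ∈ A ∨ v = u) ∧ ¬ (ends l).IsDiag
  have hagA : ∀ z z' : α → Bool, (∀ l, ins l → z l = z' l) →
      ∀ l, (∀ v ∈ ends l, v ∈ A ∨ v = u) → ¬ (ends l).IsDiag → z l = z' l :=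
    fun z z' h l hl hd => h l ⟨hl, hd⟩
  have hagT : ∀ z z' : α → Bool, (∀ l, ¬ ins l → z l = z' l) →
      ∀ l, (∀ v ∈ ends l, v ∈ T ∨ v = u) → ¬ (ends l).IsDiag → z l = z' l := by
    intro z z' h l hl hd
    refine h l fun hins => hd (isDiag_of_forall_eq (a := u) fun v hv => ?_)
    rcases hins.1 v hv with h1 | h1
    · rcases hl v hv with h2 | h2
      · exact absurd h1 h2.1
      · exact h2
    · exact h1
  -- `{a ↔ u}` is determined inside, the three `u`-events outside
  have hCn_in : ∀ z z' : α → Bool, (∀ l, ins l → z l = z' l) →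
      (openGraph (labelledOpen ends z)).Reachable a u → (openGraph (labelledOpen ends z')).Reachable a u :=
    fun z z' h hz => ((reachable_iff_of_agree_inside ends u A hsep huA (hagA z z' h) (Or.inl ha)).1 hz.symm).symm
  have hflatT : ∀ z z' : α → Bool, (∀ l, ¬ ins l → z l = z' l) →
      ∀ l, (∀ v ∈ ends l, v ∈ T ∨ v = u) → ¬ (ends l).IsDiag →
        clusterFlip ends u (fun x => !z x) l = clusterFlip ends u (fun x => !z' x) l :=
    fun z z' h l hl hd => flat_apply_eq_of_agree ends u T hsepT huT (hagT z z' h) hl hd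
  have hbad_out : ∀ z z' : α → Bool, (∀ l, ¬ ins l → z l = z' l) →
      ((¬ (openGraph (labelledOpen ends z)).Reachable u s ∧ ¬ (openGraph (labelledOpen ends z)).Reachable u c ∧
          ¬ (openGraph (labelledOpen ends z)).Reachable s c) ∧
        (openGraph (labelledOpen ends (clusterFlip ends u fun x => !z x))).Reachable s c) →
      ((¬ (openGraph (labelledOpen ends z')).Reachable u s ∧ ¬ (openGraph (labelledOpen ends z')).Reachable u c ∧
          ¬ (openGraph (labelledOpen ends z')).Reachable s c) ∧
        (openGraph (labelledOpen ends (clusterFlip ends u fun x => !z' x))).Reachable s c) := by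
    rintro z z' h ⟨⟨h1, h2, h3⟩, h4⟩
    refine ⟨⟨fun h' => h1 ((reachable_iff_of_agree_outside ends u A hsep huA (hagT z z' h) (Or.inr rfl) hsT).2 h'),
      fun h' => h2 ((reachable_iff_of_agree_outside ends u A hsep huA (hagT z z' h) (Or.inr rfl) hcT).2 h'),
      fun h' => h3 ((reachable_iff_of_agree_outside ends u A hsep huA (hagT z z' h) hsT hcT).2 h')⟩, ?_⟩
    exact (reachable_iff_of_agree_outside ends u A hsep huA (hflatT z z' h) hsT hcT).1 h4
  have hP1_out : ∀ z z' : α → Bool, (∀ l, ¬ ins l → z l = z' l) →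
      ((openGraph (labelledOpen ends z)).Reachable u s ∧ ¬ (openGraph (labelledOpen ends z)).Reachable u c) →
      ((openGraph (labelledOpen ends z')).Reachable u s ∧ ¬ (openGraph (labelledOpen ends z')).Reachable u c) := by
    rintro z z' h ⟨h1, h2⟩
    exact ⟨(reachable_iff_of_agree_outside ends u A hsep huA (hagT z z' h) (Or.inr rfl) hsT).1 h1,
      fun h' => h2 ((reachable_iff_of_agree_outside ends u A hsep huA (hagT z z' h) (Or.inr rfl) hcT).2 h')⟩
  have hP2_out : ∀ z z' : α → Bool, (∀ l, ¬ ins l → z l = z' l) →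
      ((openGraph (labelledOpen ends z)).Reachable u c ∧ ¬ (openGraph (labelledOpen ends z)).Reachable u s) →
      ((openGraph (labelledOpen ends z')).Reachable u c ∧ ¬ (openGraph (labelledOpen ends z')).Reachable u s) := by
    rintro z z' h ⟨h1, h2⟩
    exact ⟨(reachable_iff_of_agree_outside ends u A hsep huA (hagT z z' h) (Or.inr rfl) hcT).1 h1,
      fun h' => h2 ((reachable_iff_of_agree_outside ends u A hsep huA (hagT z z' h) (Or.inr rfl) hsT).2 h')⟩
  -- rewrite the three `a`-events as `{a ↔ u} ∩ (u-event)`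
  have ebad := Finset.filter_congr (s := (univ : Finset (α → Bool)))
    fun z _ => bad_iff_apexTransfer ends u A hsep huA ha hs hsu hc hcu z
  have eP1 := Finset.filter_congr (s := (univ : Finset (α → Bool)))
    fun z _ => sa_iff_apexTransfer ends u A hsep huA (c := c) ha hs z
  have eP2 := Finset.filter_congr (s := (univ : Finset (α → Bool)))
    fun z _ => sa_iff_apexTransfer ends u A hsep huA (c := s) ha hc z
  rw [ebad, eP1, eP2]
  -- the three independence counts
  have hIbad := card_and_mul_card_univ ins
    (fun z => (openGraph (labelledOpen ends z)).Reachable a u)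
    (fun z => (¬ (openGraph (labelledOpen ends z)).Reachable u s ∧ ¬ (openGraph (labelledOpen ends z)).Reachable u c ∧
          ¬ (openGraph (labelledOpen ends z)).Reachable s c) ∧
        (openGraph (labelledOpen ends (clusterFlip ends u fun x => !z x))).Reachable s c)
    hCn_in hbad_out
  have hIP1 := card_and_mul_card_univ ins
    (fun z => (openGraph (labelledOpen ends z)).Reachable a u)
    (fun z => (openGraph (labelledOpen ends z)).Reachable u s ∧ ¬ (openGraph (labelledOpen ends z)).Reachable u c)
    hCn_in hP1_out
  have hIP2 := card_and_mul_card_univ ins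
    (fun z => (openGraph (labelledOpen ends z)).Reachable a u)
    (fun z => (openGraph (labelledOpen ends z)).Reachable u c ∧ ¬ (openGraph (labelledOpen ends z)).Reachable u s)
    hCn_in hP2_out
  beta_reduce at hIbad hIP1 hIP2
  -- abbreviate
  set U := (univ : Finset (α → Bool)).card with hU
  set Cn := (univ.filter fun z : α → Bool => (openGraph (labelledOpen ends z)).Reachable a u).card with hCn
  set Bu := (univ.filter fun z : α → Bool =>
        (¬ (openGraph (labelledOpen ends z)).Reachable u s ∧ ¬ (openGraph (labelledOpen ends z)).Reachable u c ∧
            ¬ (openGraph (labelledOpen ends z)).Reachable s c) ∧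
          (openGraph (labelledOpen ends (clusterFlip ends u fun x => !z x))).Reachable s c).card with hBu
  set Q1u := (univ.filter fun z : α → Bool =>
        (openGraph (labelledOpen ends z)).Reachable u s ∧ ¬ (openGraph (labelledOpen ends z)).Reachable u c).card with hQ1u
  set Q2u := (univ.filter fun z : α → Bool =>
        (openGraph (labelledOpen ends z)).Reachable u c ∧ ¬ (openGraph (labelledOpen ends z)).Reachable u s).card with hQ2u
  set Ba := (univ.filter fun z : α → Bool => (openGraph (labelledOpen ends z)).Reachable a u ∧
        ((¬ (openGraph (labelledOpen ends z)).Reachable u s ∧ ¬ (openGraph (labelledOpen ends z)).Reachable u c ∧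
            ¬ (openGraph (labelledOpen ends z)).Reachable s c) ∧
          (openGraph (labelledOpen ends (clusterFlip ends u fun x => !z x))).Reachable s c)).card with hBa
  set Q1a := (univ.filter fun z : α → Bool => (openGraph (labelledOpen ends z)).Reachable a u ∧
        ((openGraph (labelledOpen ends z)).Reachable u s ∧ ¬ (openGraph (labelledOpen ends z)).Reachable u c)).card with hQ1a
  set Q2a := (univ.filter fun z : α → Bool => (openGraph (labelledOpen ends z)).Reachable a u ∧
        ((openGraph (labelledOpen ends z)).Reachable u c ∧ ¬ (openGraph (labelledOpen ends z)).Reachable u s)).card with hQ2a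
  have hUpos : 0 < U := Finset.card_pos.mpr Finset.univ_nonempty
  have key : Ba * U * (Ba * U) ≤ Q1a * U * (Q2a * U) := by
    rw [hIbad, hIP1, hIP2]
    calc Cn * Bu * (Cn * Bu) = (Cn * Cn) * Bu ^ 2 := by ring
      _ ≤ (Cn * Cn) * (Q1u * Q2u) := Nat.mul_le_mul_left _ hP
      _ = Cn * Q1u * (Cn * Q2u) := by ring
  have key' : Ba ^ 2 * (U * U) ≤ Q1a * Q2a * (U * U) := by
    calc Ba ^ 2 * (U * U) = Ba * U * (Ba * U) := by ring
      _ ≤ Q1a * U * (Q2a * U) := key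
      _ = Q1a * Q2a * (U * U) := by ring
  exact Nat.le_of_mul_le_mul_right key' (Nat.mul_pos hUpos hUpos)

end Transfer

end Summit.CriticalPhenomena.PercolationContinuityZ3.Theorems.ProductFormFibre
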